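import Summits.CriticalPhenomena.PercolationContinuityZ3.Theorems.SahiBoxTP2Split
import Literature.Probability.LatticeModels.IsingStateIdentification
import Literature.Probability.LatticeModels.IsingBoundaryMonotonicity

/-!
# The finite-volume Ising measures and their thermodynamic limits (`μ⁺`, `μ⁻`, `μ^∅`) are box-TP₂

Support file of the Sahi cell (`prim-sahi`, typer seat, generation 13; `--supports stmt-CriticalPhenomena-4575`).
Theorems only (no definitions, no named facts, no sorries).  Companion: `SahiIsingGibbsStates.lean` (Sahi
positivity of the infinite-volume Ising states given `C_n`; unconditional FKG for all measurable monotone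
functionals).

Generation 12 proved: a probability measure on `{0,1}^ι` (`ι` countable) whose cylinder probabilities satisfy the
FKG lattice condition is box-TP₂ and hence, GIVEN `C_n` (⟺ `∀ d, LiebSahiContinuum d n`), Sahi-positive of order
`n` for all measurable monotone functionals of the whole configuration; the docstrings named "Ising `±`/free
states" as the intended examples.  This file PROVES the box-TP₂ property for the tree's nearest-neighbour Ising
model (`Literature.Probability.LatticeModels.IsingModel`, `GibbsStates`, `PlusMinusStateGibbs`, `FreeStateGibbs`):

* `isBoxTP2_isingMeasure` — for EVERY countable locally finite graph, every finite volume `Λ`, `β ≥ 0`, every field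
  `h` and every boundary condition, the finite-volume Gibbs measure `μ^{bc}_{Λ;β,h}`, as a measure on the INFINITE
  configuration space `{−1,+1}^V`, is box-TP₂: `μ[a,b] μ[a',b'] ≤ μ[a ∧ a', b ∧ b'] μ[a ∨ a', b ∨ b']` for all order
  boxes (the FKG lattice condition of the Boltzmann weights on `{−1,+1}^Λ`, `isingWeight_lattice_condition`, and the
  four functions theorem applied to the glued preimages of the two boxes, whose pointwise meets and joins glue
  into the meet and join boxes).
* `isBoxTP2_of_tendsto_local` — box-TP₂ on `{−1,+1}^ι` (`ι` countable) is closed under convergence on local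
  events: the faces of a box over finite windows are local boxes (free coordinates padded by `∓1`), decreasing to
  the box along an exhaustion of `ι` (continuity from above).  Hence every thermodynamic limit of finite-volume
  Ising measures with ANY volumes and ANY boundary conditions is box-TP₂ (`isBoxTP2_of_tendsto_isingMeasure`), in
  particular every probability measure on `{−1,+1}^{ℤ^d}` with the correlations of the plus state, of the minus
  state (`β ≥ 0`, any `h`) or of the free state (`β, h ≥ 0`) — i.e. the states `μ⁺_{β,h}`, `μ⁻_{β,h}`, `μ^∅_{β,h}`
  of `exists_plusMeasure` / `exists_minusMeasure` / `exists_freeMeasure`, which are determined by their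
  correlations — is box-TP₂ (`isBoxTP2_of_forall_spinCorr_eq_plusCorr` / `…_minusCorr` / `…_freeCorr`; local
  events converge by `integral_eq_limUnder_isingExpect_box_of_forall_spinCorr`).

No sorries, no new axioms.
-/

noncomputable section

namespace Summit.CriticalPhenomena.PercolationContinuityZ3.Theorems.SahiBoxTP2

open MeasureTheory ProbabilityTheory Set Filter Topology Function Literature.Combinatorics.Sahi2008
open Literature.Probability.LatticeModels
open scoped ENNReal

/-! ### The spin lattice `{−1,+1}^ι`: measurable boxes, face boxes over finite windows -/

section Spins

variable {ι : Type*}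

/-- Order boxes of a countable product of countable discrete measurable spaces are measurable. [folklore] -/
theorem measurableSet_Icc_pi_of_countable {X : Type*} [Countable ι] [Preorder X] [MeasurableSpace X]
    [MeasurableSingletonClass X] [Countable X] (a b : ι → X) : MeasurableSet (Icc a b) := by
  rw [← Set.pi_univ_Icc]
  exact MeasurableSet.univ_pi fun i => (Set.to_countable _).measurableSet

/-- Order boxes of `{−1,+1}^ι` (`ι` countable) are measurable. [folklore] -/
theorem measurableSet_Icc_spinConfig [Countable ι] (a b : ι → ℤˣ) : MeasurableSet (Icc a b) :=
  measurableSet_Icc_pi_of_countable a b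

variable [DecidableEq ι]

/-- `Finset.piecewise` with a common complement commutes with binary meets. [folklore] -/
theorem piecewise_inf {X : Type*} [Lattice X] (J : Finset ι) (a a' c : ι → X) :
    J.piecewise (a ⊓ a') c = J.piecewise a c ⊓ J.piecewise a' c := by
  funext i
  by_cases hi : i ∈ J
  · simp only [Pi.inf_apply, Finset.piecewise_eq_of_mem _ _ _ hi]
  · simp only [Pi.inf_apply, Finset.piecewise_eq_of_notMem _ _ _ hi, inf_idem]

/-- `Finset.piecewise` with a common complement commutes with binary joins. [folklore] -/
theorem piecewise_sup {X : Type*} [Lattice X] (J : Finset ι) (a a' c : ι → X) :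
    J.piecewise (a ⊔ a') c = J.piecewise a c ⊔ J.piecewise a' c := by
  funext i
  by_cases hi : i ∈ J
  · simp only [Pi.sup_apply, Finset.piecewise_eq_of_mem _ _ _ hi]
  · simp only [Pi.sup_apply, Finset.piecewise_eq_of_notMem _ _ _ hi, sup_idem]

/-- Membership in the `J`-face box `[J.piecewise a (−1), J.piecewise b 1]` only constrains the coordinates in `J`.
[folklore] -/
theorem mem_Icc_piecewise_iff (J : Finset ι) (a b σ : ι → ℤˣ) :
    σ ∈ Icc (J.piecewise a (-1)) (J.piecewise b 1) ↔ ∀ v ∈ J, a v ≤ σ v ∧ σ v ≤ b v := by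
  simp only [mem_Icc, Pi.le_def]
  constructor
  · rintro ⟨h1, h2⟩ v hv
    exact ⟨by simpa only [Finset.piecewise_eq_of_mem _ _ _ hv] using h1 v,
      by simpa only [Finset.piecewise_eq_of_mem _ _ _ hv] using h2 v⟩
  · intro h
    refine ⟨fun v => ?_, fun v => ?_⟩
    · by_cases hv : v ∈ J
      · rw [Finset.piecewise_eq_of_mem _ _ _ hv]; exact (h v hv).1
      · rw [Finset.piecewise_eq_of_notMem _ _ _ hv]; exact neg_one_le_intUnits _
    · by_cases hv : v ∈ J
      · rw [Finset.piecewise_eq_of_mem _ _ _ hv]; exact (h v hv).2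
      · rw [Finset.piecewise_eq_of_notMem _ _ _ hv]; exact intUnits_le_one _

/-- The `J`-face box is a local event (determined by the spins in `J`). [folklore] -/
theorem dependsOn_mem_Icc_piecewise (J : Finset ι) (a b : ι → ℤˣ) :
    DependsOn (fun σ : ι → ℤˣ => σ ∈ Icc (J.piecewise a (-1)) (J.piecewise b 1)) (↑J : Set ι) := by
  intro σ τ hστ
  simp only [mem_Icc_piecewise_iff]
  refine propext (forall₂_congr fun v hv => ?_)
  rw [hστ v (Finset.mem_coe.2 hv)]

/-- A box lies in each of its face boxes. [folklore] -/
theorem Icc_subset_Icc_piecewise (J : Finset ι) (a b : ι → ℤˣ) :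
    Icc a b ⊆ Icc (J.piecewise a (-1)) (J.piecewise b 1) := fun σ hσ =>
  (mem_Icc_piecewise_iff J a b σ).2 fun v _ => ⟨hσ.1 v, hσ.2 v⟩

/-- Along an increasing sequence of windows the face boxes decrease. [folklore] -/
theorem antitone_Icc_piecewise {J : ℕ → Finset ι} (hJ : Monotone J) (a b : ι → ℤˣ) :
    Antitone fun m => Icc ((J m).piecewise a (-1)) ((J m).piecewise b 1) := by
  intro m m' hmm' σ hσ
  rw [mem_Icc_piecewise_iff] at hσ ⊢
  exact fun v hv => hσ v (hJ hmm' hv)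

/-- Along an exhausting sequence of windows the face boxes decrease to the box. [folklore] -/
theorem iInter_Icc_piecewise {J : ℕ → Finset ι} (hJ : ∀ v, ∃ m, v ∈ J m) (a b : ι → ℤˣ) :
    ⋂ m, Icc ((J m).piecewise a (-1)) ((J m).piecewise b 1) = Icc a b := by
  refine Subset.antisymm (fun σ hσ => ?_) (subset_iInter fun m => Icc_subset_Icc_piecewise (J m) a b)
  rw [mem_iInter] at hσ
  refine ⟨fun v => ?_, fun v => ?_⟩
  · obtain ⟨m, hm⟩ := hJ v
    exact (((mem_Icc_piecewise_iff _ _ _ _).1 (hσ m)) v hm).1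
  · obtain ⟨m, hm⟩ := hJ v
    exact (((mem_Icc_piecewise_iff _ _ _ _).1 (hσ m)) v hm).2

omit [DecidableEq ι] in
/-- A countable index set has an increasing exhausting sequence of finite windows. [folklore] -/
theorem exists_finset_exhaustion [Countable ι] : ∃ J : ℕ → Finset ι, Monotone J ∧ ∀ v, ∃ m, v ∈ J m := by
  obtain ⟨f, hf⟩ := Countable.exists_injective_nat ι
  refine ⟨fun m => (Finset.range m).preimage f (hf.injOn), fun m m' hmm' v hv => ?_, fun v => ⟨f v + 1, ?_⟩⟩
  · rw [Finset.mem_preimage, Finset.mem_range] at hv ⊢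
    exact lt_of_lt_of_le hv hmm'
  · rw [Finset.mem_preimage, Finset.mem_range]
    exact Nat.lt_succ_self _

end Spins

/-! ### Box-TP₂ on `{−1,+1}^ι` is closed under convergence on local events -/

section Closure

variable {ι : Type*} [Countable ι]

/-- **Closure of box-TP₂ under local convergence.**  If finite box-TP₂ measures `μ_L` on `{−1,+1}^ι` (`ι` countable)
converge to a finite measure `μ` on every measurable local event (an event determined by the spins in a finite
window), then `μ` is box-TP₂: the inequality for the four face boxes over a finite window passes to the limit in
`L`, and the face boxes decrease to the boxes along an exhaustion of `ι` (continuity from above). [this work] -/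
theorem isBoxTP2_of_tendsto_local (μs : ℕ → Measure (ι → ℤˣ)) (μ : Measure (ι → ℤˣ))
    [∀ L, IsFiniteMeasure (μs L)] [IsFiniteMeasure μ] (hbox : ∀ L, IsBoxTP2 (μs L))
    (hconv : ∀ (J : Finset ι) (C : Set (ι → ℤˣ)), MeasurableSet C → DependsOn (fun σ => σ ∈ C) (↑J : Set ι) →
      Tendsto (fun L => μs L C) atTop (𝓝 (μ C))) :
    IsBoxTP2 μ := by
  classical
  obtain ⟨J, hJm, hJ⟩ := exists_finset_exhaustion (ι := ι)
  -- the face boxes over the window `J m`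
  set F : ℕ → (ι → ℤˣ) → (ι → ℤˣ) → Set (ι → ℤˣ) :=
    fun m p q => Icc ((J m).piecewise p (-1)) ((J m).piecewise q 1) with hF
  have hFm : ∀ m p q, MeasurableSet (F m p q) := fun m p q => measurableSet_Icc_spinConfig _ _
  have hfinμ : ∀ s : Set (ι → ℤˣ), μ s ≠ ∞ := fun s => measure_ne_top μ s
  -- step 1: the inequality for the face boxes of `μ`, by the limit in `L`
  have hface : ∀ (m : ℕ) (a b a' b' : ι → ℤˣ),
      μ (F m a b) * μ (F m a' b') ≤ μ (F m (a ⊓ a') (b ⊓ b')) * μ (F m (a ⊔ a') (b ⊔ b')) := by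
    intro m a b a' b'
    have hc : ∀ p q, Tendsto (fun L => μs L (F m p q)) atTop (𝓝 (μ (F m p q))) := fun p q =>
      hconv (J m) _ (hFm m p q) (dependsOn_mem_Icc_piecewise (J m) p q)
    refine le_of_tendsto_of_tendsto'
      (ENNReal.Tendsto.mul (hc a b) (Or.inr (hfinμ _)) (hc a' b') (Or.inr (hfinμ _)))
      (ENNReal.Tendsto.mul (hc (a ⊓ a') (b ⊓ b')) (Or.inr (hfinμ _)) (hc (a ⊔ a') (b ⊔ b'))
        (Or.inr (hfinμ _))) fun L => ?_
    have key := hbox L ((J m).piecewise a (-1)) ((J m).piecewise b 1) ((J m).piecewise a' (-1))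
      ((J m).piecewise b' 1)
    simp only [hF, piecewise_inf, piecewise_sup]
    exact key
  -- step 2: continuity from above along the exhaustion
  have hlim : ∀ p q : ι → ℤˣ, Tendsto (fun m => μ (F m p q)) atTop (𝓝 (μ (Icc p q))) := by
    intro p q
    have h := tendsto_measure_iInter_atTop (μ := μ) (fun m => (hFm m p q).nullMeasurableSet)
      (antitone_Icc_piecewise hJm p q) ⟨0, hfinμ _⟩
    rw [iInter_Icc_piecewise hJ p q] at h
    exact h
  intro a b a' b'
  exact le_of_tendsto_of_tendsto'
    (ENNReal.Tendsto.mul (hlim a b) (Or.inr (hfinμ _)) (hlim a' b') (Or.inr (hfinμ _)))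
    (ENNReal.Tendsto.mul (hlim (a ⊓ a') (b ⊓ b')) (Or.inr (hfinμ _)) (hlim (a ⊔ a') (b ⊔ b'))
      (Or.inr (hfinμ _))) fun m => hface m a b a' b'

end Closure

/-! ### Finite-volume Ising measures are box-TP₂ on the whole configuration space -/

section FiniteVolume

variable {V : Type*} (G : SimpleGraph V) [DecidableEq V] [G.LocallyFinite]

open scoped FinsetFamily in
/-- **The finite-volume Ising measure `μ^{bc}_{Λ;β,h}` (`β ≥ 0`, any field, any boundary condition, any countable
locally finite graph) is box-TP₂ on `{−1,+1}^V`**: for all order boxes,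
`μ[a,b] μ[a',b'] ≤ μ[a ∧ a', b ∧ b'] μ[a ∨ a', b ∨ b']`.  The mass of a box is the Boltzmann-weighted count of the
finite configurations `τ ∈ {−1,+1}^Λ` glued into it (`isingMeasure_apply_of_measurableSet`); the weights satisfy
the FKG lattice condition (`isingWeight_lattice_condition`), and by the four functions theorem the product of the
two counts is at most the product of the counts of the pointwise meets and joins, which glue into the meet box
and the join box (`glue_inf`, `glue_sup`). [this work] -/
theorem isBoxTP2_isingMeasure [Countable V] (Λ : Finset V) {β : ℝ} (hβ : 0 ≤ β) (h : ℝ)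
    (bc : BoundaryCondition V) : IsBoxTP2 (isingMeasure G Λ β h bc) := by
  classical
  intro a b a' b'
  set w : (Λ → ℤˣ) → ℝ := isingWeight G Λ β h bc with hw
  set Z : ℝ := isingPartitionFunction G Λ β h bc with hZ
  have hZpos : 0 < Z := isingPartitionFunction_pos G Λ β h bc
  have hw0 : 0 ≤ w := fun τ => (isingWeight_pos G Λ β h bc τ).le
  -- the glued preimage of a box
  set S : (V → ℤˣ) → (V → ℤˣ) → Finset (Λ → ℤˣ) :=
    fun p q => Finset.univ.filter fun τ => glue Λ τ bc ∈ Icc p q with hS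
  have happly : ∀ p q : V → ℤˣ,
      isingMeasure G Λ β h bc (Icc p q) = ENNReal.ofReal ((∑ τ ∈ S p q, w τ) / Z) := fun p q => by
    rw [isingMeasure_apply_of_measurableSet G Λ β h bc (measurableSet_Icc_spinConfig p q)]
  have hsum0 : ∀ p q : V → ℤˣ, 0 ≤ (∑ τ ∈ S p q, w τ) / Z := fun p q =>
    div_nonneg (Finset.sum_nonneg fun τ _ => hw0 τ) hZpos.le
  rw [happly, happly, happly, happly, ← ENNReal.ofReal_mul (hsum0 _ _), ← ENNReal.ofReal_mul (hsum0 _ _)]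
  refine ENNReal.ofReal_le_ofReal ?_
  rw [div_mul_div_comm, div_mul_div_comm]
  refine div_le_div_of_nonneg_right ?_ (mul_pos hZpos hZpos).le
  -- four functions on `{−1,+1}^Λ`
  have h4 := four_functions_theorem w w w w hw0 hw0 hw0 hw0
    (fun τ τ' => isingWeight_lattice_condition G Λ hβ h bc τ τ') (S a b) (S a' b')
  have hinfs : S a b ⊼ S a' b' ⊆ S (a ⊓ a') (b ⊓ b') := by
    intro c hc
    rw [Finset.mem_infs] at hc
    obtain ⟨τ, hτ, τ', hτ', rfl⟩ := hc
    simp only [hS, Finset.mem_filter, Finset.mem_univ, true_and, mem_Icc] at hτ hτ' ⊢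
    rw [glue_inf]
    exact ⟨le_inf (inf_le_left.trans hτ.1) (inf_le_right.trans hτ'.1), inf_le_inf hτ.2 hτ'.2⟩
  have hsups : S a b ⊻ S a' b' ⊆ S (a ⊔ a') (b ⊔ b') := by
    intro c hc
    rw [Finset.mem_sups] at hc
    obtain ⟨τ, hτ, τ', hτ', rfl⟩ := hc
    simp only [hS, Finset.mem_filter, Finset.mem_univ, true_and, mem_Icc] at hτ hτ' ⊢
    rw [glue_sup]
    exact ⟨sup_le_sup hτ.1 hτ'.1, sup_le (hτ.2.trans le_sup_left) (hτ'.2.trans le_sup_right)⟩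
  calc (∑ τ ∈ S a b, w τ) * ∑ τ ∈ S a' b', w τ
      ≤ (∑ τ ∈ S a b ⊼ S a' b', w τ) * ∑ τ ∈ S a b ⊻ S a' b', w τ := h4
    _ ≤ (∑ τ ∈ S (a ⊓ a') (b ⊓ b'), w τ) * ∑ τ ∈ S (a ⊔ a') (b ⊔ b'), w τ :=
        mul_le_mul (Finset.sum_le_sum_of_subset_of_nonneg hinfs fun τ _ _ => hw0 τ)
          (Finset.sum_le_sum_of_subset_of_nonneg hsups fun τ _ _ => hw0 τ)
          (Finset.sum_nonneg fun τ _ => hw0 τ) (Finset.sum_nonneg fun τ _ => hw0 τ)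

/-- **Thermodynamic limits of finite-volume Ising measures are box-TP₂** (any countable locally finite graph, any
volumes `Λ_L`, any boundary conditions `bc_L`, `β ≥ 0`): if `μ^{bc_L}_{Λ_L;β,h}(C) → μ(C)` for every measurable
local event `C`, then `μ` is box-TP₂. [this work] -/
theorem isBoxTP2_of_tendsto_isingMeasure [Countable V] (Λs : ℕ → Finset V) (bcs : ℕ → BoundaryCondition V)
    {β : ℝ} (hβ : 0 ≤ β) (h : ℝ) (μ : Measure (V → ℤˣ)) [IsFiniteMeasure μ]
    (hconv : ∀ (J : Finset V) (C : Set (V → ℤˣ)), MeasurableSet C → DependsOn (fun σ => σ ∈ C) (↑J : Set V) →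
      Tendsto (fun L => isingMeasure G (Λs L) β h (bcs L) C) atTop (𝓝 (μ C))) :
    IsBoxTP2 μ :=
  isBoxTP2_of_tendsto_local (fun L => isingMeasure G (Λs L) β h (bcs L)) μ
    (fun L => isBoxTP2_isingMeasure G (Λs L) hβ h (bcs L)) hconv

end FiniteVolume

/-! ### The plus, minus and free states of the Ising model on `ℤ^d` are box-TP₂ -/

section States

variable {d : ℕ} {β h : ℝ}

/-- **Local events under box limits with convergent correlations.**  If the box correlations
`⟨σ_B⟩^{bc}_{B(L);β,h}` converge to `c B` for every finite `B`, and `μ` is a probability measure with correlations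
`c`, then `μ^{bc}_{B(L);β,h}(C) → μ(C)` for every measurable local event `C` (the indicator of `C` is a local
observable, a finite combination of spin products: `integral_eq_limUnder_isingExpect_box_of_forall_spinCorr`).
[this work] -/
theorem tendsto_isingMeasure_box_of_forall_spinCorr (bc : BoundaryCondition (Site d)) {c : Finset (Site d) → ℝ}
    (hcorr : ∀ B : Finset (Site d),
      Tendsto (fun L : ℕ => isingCorr (zdGraph d) (box d L) β h bc B) atTop (𝓝 (c B)))
    (μ : Measure (SpinConfig (Site d))) [IsProbabilityMeasure μ] (hμ : ∀ B : Finset (Site d), spinCorr μ B = c B)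
    (J : Finset (Site d)) {C : Set (SpinConfig (Site d))} (hCm : MeasurableSet C)
    (hC : DependsOn (fun σ => σ ∈ C) (↑J : Set (Site d))) :
    Tendsto (fun L : ℕ => isingMeasure (zdGraph d) (box d L) β h bc C) atTop (𝓝 (μ C)) := by
  classical
  set F : SpinConfig (Site d) → ℝ := C.indicator 1 with hFdef
  have hF : DependsOn F (↑J : Set (Site d)) := by
    intro σ τ hστ
    have e : (σ ∈ C) = (τ ∈ C) := hC hστ
    simp only [hFdef, Set.indicator_apply, e, Pi.one_apply]
  obtain ⟨a, ha⟩ := tendsto_isingExpect_box_of_dependsOn bc hcorr J hF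
  have hlim : Tendsto (fun L : ℕ => isingExpect (zdGraph d) (box d L) β h bc F) atTop (𝓝 (∫ σ, F σ ∂μ)) := by
    rw [integral_eq_limUnder_isingExpect_box_of_forall_spinCorr bc hcorr μ hμ hF]
    exact tendsto_nhds_limUnder ⟨a, ha⟩
  have e1 : (fun L : ℕ => isingExpect (zdGraph d) (box d L) β h bc F) =
      fun L => (isingMeasure (zdGraph d) (box d L) β h bc).real C := by
    funext L
    rw [isingExpect, hFdef, integral_indicator_one hCm]
  rw [e1, hFdef, integral_indicator_one hCm] at hlim
  have h2 := ENNReal.tendsto_ofReal hlim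
  have e2 : (fun L : ℕ => ENNReal.ofReal ((isingMeasure (zdGraph d) (box d L) β h bc).real C)) =
      fun L => isingMeasure (zdGraph d) (box d L) β h bc C :=
    funext fun L => ofReal_measureReal (measure_ne_top _ _)
  rwa [e2, ofReal_measureReal (measure_ne_top _ _)] at h2

/-- **A state with convergent box correlations is box-TP₂** (`β ≥ 0`): if the box correlations with boundary
condition `bc` converge to `c` and `μ` is a probability measure with correlations `c`, then `μ` is box-TP₂.
[this work] -/
theorem isBoxTP2_of_forall_spinCorr_eq (bc : BoundaryCondition (Site d)) (hβ : 0 ≤ β)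
    {c : Finset (Site d) → ℝ}
    (hcorr : ∀ B : Finset (Site d),
      Tendsto (fun L : ℕ => isingCorr (zdGraph d) (box d L) β h bc B) atTop (𝓝 (c B)))
    (μ : Measure (SpinConfig (Site d))) [IsProbabilityMeasure μ]
    (hμ : ∀ B : Finset (Site d), spinCorr μ B = c B) : IsBoxTP2 μ :=
  isBoxTP2_of_tendsto_isingMeasure (zdGraph d) (fun L => box d L) (fun _ => bc) hβ h μ
    fun J _ hCm hC => tendsto_isingMeasure_box_of_forall_spinCorr bc hcorr μ hμ J hCm hC

/-- **The plus state is box-TP₂**: for `β ≥ 0` and every `h`, every probability measure on `{−1,+1}^{ℤ^d}` with the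
correlations of the plus state `⟨σ_B⟩⁺_{β,h}` (there is exactly one, the plus state `μ⁺_{β,h}` of
`exists_plusMeasure`) satisfies `μ[a,b] μ[a',b'] ≤ μ[a ∧ a', b ∧ b'] μ[a ∨ a', b ∨ b']` for all order boxes.
[this work] -/
theorem isBoxTP2_of_forall_spinCorr_eq_plusCorr (hβ : 0 ≤ β) (μ : Measure (SpinConfig (Site d)))
    [IsProbabilityMeasure μ] (hμ : ∀ B : Finset (Site d), spinCorr μ B = plusCorr d β h B) : IsBoxTP2 μ :=
  isBoxTP2_of_forall_spinCorr_eq .plus hβ (tendsto_isingCorr_plus_box hβ h) μ hμ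

/-- **The minus state is box-TP₂** (`β ≥ 0`, every `h`). [this work] -/
theorem isBoxTP2_of_forall_spinCorr_eq_minusCorr (hβ : 0 ≤ β) (μ : Measure (SpinConfig (Site d)))
    [IsProbabilityMeasure μ] (hμ : ∀ B : Finset (Site d), spinCorr μ B = minusCorr d β h B) : IsBoxTP2 μ :=
  isBoxTP2_of_forall_spinCorr_eq .minus hβ (tendsto_isingCorr_minus_box hβ h) μ hμ

/-- **The free state is box-TP₂** (`β ≥ 0`, `h ≥ 0`, where the tree has the box limits by GKS). [this work] -/
theorem isBoxTP2_of_forall_spinCorr_eq_freeCorr (hβ : 0 ≤ β) (hh : 0 ≤ h) (μ : Measure (SpinConfig (Site d)))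
    [IsProbabilityMeasure μ] (hμ : ∀ B : Finset (Site d), spinCorr μ B = freeCorr d β h B) : IsBoxTP2 μ :=
  isBoxTP2_of_forall_spinCorr_eq .free hβ
    (fun B => tendsto_isingExpect_free_box_of_dependsOn hβ hh B fun σ τ hst =>
      Finset.prod_congr rfl fun x hx => by simp only [spinAt, hst x (Finset.mem_coe.2 hx)]) μ hμ

end States

end Summit.CriticalPhenomena.PercolationContinuityZ3.Theorems.SahiBoxTP2
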